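import Summits.Ventures.GridStability.Models.NE39DAEHessianData
import HarnessLib

/-!
# GridStability/Models/NE39DAEHessianEntries — «NE39-DAE»: kernel check that the literal pinned Gram matrix
# IS the closed-form second variation at the printed operating point (87 × 87 = 7569 entries)

LADDER-GRIDFUSION G3/G2, seat gridfusion-model-2 (g9); `plan/MODEL-VALIDITY.md` row **MV-4** (c), instance
«NE39-DAE». Data: `NE39DAEHessianData.lean` (`tables`, `pinIdx`, `Qrows`, `pinnedHessianQ`). Each block
below decides, in the kernel, `(Matrix.of tables.entry).submatrix pinIdx pinIdx i j = pinnedHessianQ i j` on a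
range of rows (the closed-form evaluator `HessianTables.entry` of `StructurePreservingDAEHessianEntry.lean`,
`O(n)` per entry; measured ≈ 1 kernel-s per row); `pinnedGram39_eq_literal` assembles them and rewrites
`Matrix.of tables.entry = tables.matrix` (`matrix_eq_of_entry`). [cite: Padiyar2013, §3.4.4 eq (3.32)]
CERTIFIED column raw checks; no inequality is concluded in this file.
-/

noncomputable section

open Summit.Ventures.GridStability.Models.StructurePreservingDAE
open Literature.Computation.Certificates

namespace Summit.Ventures.GridStability.Models.NE39DAE

set_option maxHeartbeats 0 in
/-- Kernel check, rows 0–21: the literal agrees with the closed-form second variation. [folklore] -/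
theorem pinnedHessianQ_eq_block0 : ∀ i j : Fin 87, 0 ≤ i.val → i.val < 22 →
    ((Matrix.of tables.entry).submatrix pinIdx pinIdx) i j = pinnedHessianQ i j := by
  decide +kernel

set_option maxHeartbeats 0 in
/-- Kernel check, rows 22–43: the literal agrees with the closed-form second variation. [folklore] -/
theorem pinnedHessianQ_eq_block1 : ∀ i j : Fin 87, 22 ≤ i.val → i.val < 44 →
    ((Matrix.of tables.entry).submatrix pinIdx pinIdx) i j = pinnedHessianQ i j := by
  decide +kernel

set_option maxHeartbeats 0 in
/-- Kernel check, rows 44–65: the literal agrees with the closed-form second variation. [folklore] -/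
theorem pinnedHessianQ_eq_block2 : ∀ i j : Fin 87, 44 ≤ i.val → i.val < 66 →
    ((Matrix.of tables.entry).submatrix pinIdx pinIdx) i j = pinnedHessianQ i j := by
  decide +kernel

set_option maxHeartbeats 0 in
/-- Kernel check, rows 66–86: the literal agrees with the closed-form second variation. [folklore] -/
theorem pinnedHessianQ_eq_block3 : ∀ i j : Fin 87, 66 ≤ i.val → i.val < 87 →
    ((Matrix.of tables.entry).submatrix pinIdx pinIdx) i j = pinnedHessianQ i j := by
  decide +kernel

/-- **The literal IS the pinned Gram matrix of the rational tables** (`tables.matrix`, via the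
closed form). [cite: Padiyar2013, §3.4.4 eq (3.32)] -/
theorem pinnedGram39_eq_literal :
    NE39DAE.tables.matrix.submatrix NE39DAE.pinIdx NE39DAE.pinIdx = NE39DAE.pinnedHessianQ := by
  rw [HessianTables.matrix_eq_of_entry]
  refine Matrix.ext fun i j => ?_
  by_cases h1 : i.val < 22
  · exact pinnedHessianQ_eq_block0 i j (Nat.zero_le _) h1
  by_cases h2 : i.val < 44
  · exact pinnedHessianQ_eq_block1 i j (by omega) h2
  by_cases h3 : i.val < 66
  · exact pinnedHessianQ_eq_block2 i j (by omega) h3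
  · exact pinnedHessianQ_eq_block3 i j (by omega) i.isLt

end Summit.Ventures.GridStability.Models.NE39DAE

end
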